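import Literature.Computability.QuantumComplexity.CleanSuffixProfileExtremes
import HarnessLib

/-!
# The first-moment profile behind a clean Clifford-type suffix is a stabiliser-intersection count

Third «clean suffix» module (cell qa-dq, census DQ-N5, lens negation), over the siblings
`DampingCleanSuffixProfile` (profile law `Ψ_C(q) = Σ_k q^{2k} V_k(C)`, sandwich
`(q²)ⁿα′ ≤ Ψ − 1 ≤ q²α′`) and `CleanSuffixProfileExtremes` (`sectorTrans_conj_head`, parity layer).
For clean suffixes of ANY depth whose layers send the tracked strings to unit-modulus multiples of
strings (every Clifford suffix does), `𝒵 := {I,Z}ⁿ`, `Φ_C` the string image: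
* **Z1** `sectorTrans_conj_path`: `π_C(P₀) = Π_{t<d}((1−r)²)^{|P_t|}·[P_d ∈ 𝒵]·((1−r)²)^{|P_d|}`;
  at `r = 0` the indicator `[P_d ∈ 𝒵]`.
* **Z2** `profileMass_eq_sum_pathWeights` (any rate: a re-weighted count) and
  `profileMass_zero_eq_card`: at `r = 0`, `Σ_k V_k(C) = |𝒵 ∩ Φ_C⁻¹𝒵|`, so the certified excess is
  `α′_C = |𝒵 ∩ Φ_C⁻¹𝒵| − 1` (for a Clifford `C` the intersection of two maximal abelian Pauli
  subgroups — a remark; only the cardinality is typed); `card_filter_ZType`: `|𝒵| = 2ⁿ`.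
* **Z3** `family_profileMass` / `avg_certificate_le_of_mass`: if every non-identity diagonal string
  has a diagonal image for exactly `b` of the `|J|` members, `Σ_j Σ_k V_k(C_j) = |J| + b(2ⁿ−1)` and
  `Σ_j Ψ_{C_j}(q) ≤ |J| + q²b(2ⁿ−1)`: member-averaged certificate `≤ 1 + q²·b(2ⁿ−1)/|J|`. Orbit
  counting for the uniform `n`-qubit Clifford measure gives `b/|J| = (2ⁿ−1)/(4ⁿ−1) = 1/(2ⁿ+1)`,
  an average excess `q²(2ⁿ−1)/(2ⁿ+1) < q²` — an UNTYPED remark for general `n`, typed at `n = 2`.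
* **Z4** the π/2 string rotations `rot Q = (1 − iσ_Q)/√2` (`rot_unitary`, `rot_conj_of_comm/anti`;
  the sibling's `parityU = rot (X⊗X)`, `parityU_eq_rot`); on two qubits the layer
  `V = R_{X⊗1}R_{1⊗X}` of single-qubit π/2 X-rotations (`Z⊗1 ↦ −Y⊗1`, `1⊗Z ↦ −1⊗Y`, `Z⊗Z ↦ Y⊗Y`):
  the certificate is IDENTICALLY `Ψ_V(q) = 1` at every rate (`vxC_certificate_eq_one`) —
  no entangling gate is needed to empty it — and the typed family `{1,V,V,V,V}` meets the Z3
  interface with `b = 1`, `|J| = 5`, `b/|J| = 1/5 = (2²−1)/(4²−1)` exactly the two-qubit Clifford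
  ratio (`fam5_uniform_hits`, `fam5_profileMass = 8`, `fam5_avg_certificate_le`: `≤ 5 + 3q²`).
* **Z5** `numbers`.

Honest scope: statements about the SIZE OF THE FIRST-MOMENT / JENSEN CERTIFICATE behind the suffix —
nothing about sampling hardness, second moments or member-wise output distributions (FGGKS Remark 22's
see-saw question, NOT TREATED); general non-Clifford layers spread strings and are NOT TREATED beyond
the siblings' sandwich; the Clifford-uniform ratio is typed only at `n = 2` by an explicit family.
Nothing here proves or refutes quantum advantage (BQP vs BPP untouched); finite identities about the
typed Pauli-path model; no sampler, spoofer or estimator is constructed.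
References: [FeffermanEtAl2023] arXiv:2306.16659 §10 (Cor. 11, Remarks 20–22), p. 16;
[AharonovEtAl2023] STOC 2023, §3.1, Lemma 4, Def. 5; [DalzellHunterJonesBrandao2022] PRX Quantum 3,
Thm 1; [KempeEtAl2010] QIC 10, §2.
-/

namespace Literature.Computability.QuantumComplexity.PauliPath.DampingCleanSuffix.Extremes.StabilizerCount

open Matrix Finset

variable {ι : Type*} [Fintype ι] [DecidableEq ι]

/-! ## §1 Image tracking through a clean suffix of any depth (Z1) -/

/-- **Z1 (image tracking, any depth, any rate).** If layer `t` of the clean suffix conjugates the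
tracked string `P_t` to a unit-modulus multiple of `P_{t+1}` (`t < d`; every Clifford layer does, for
every string), then `π_C(P₀) = Π_{t<d} ((1−r)²)^{|P_t|} · [P_d ∈ {I,Z}ⁿ] · ((1−r)²)^{|P_d|}` (at `r = 0`: the
INDICATOR `[P_d ∈ {I,Z}ⁿ]`).
[cite: FeffermanEtAl2023, §10 Remarks 20–22 (noiseless last layers permuting the σ_z sectors); AharonovEtAl2023, §3.1 (path weights under depolarizing letters)] -/
theorem sectorTrans_conj_path (r : ℝ) :
    ∀ {d : ℕ} (U : Fin d → Matrix (ι → Bool) (ι → Bool) ℂ) (x₀ : ι → Bool) (P : Fin (d + 1) → ι → Pauli)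
      (ε : Fin d → ℂ)
      (_hconj : ∀ t : Fin d, U t * pauliString (P t.castSucc) * (U t)ᴴ = ε t • pauliString (P t.succ))
      (_hε : ∀ t, ‖ε t‖ = 1),
      sectorTrans r U x₀ (P 0) =
        (∏ t : Fin d, ((1 - r) ^ 2) ^ strWeight (P t.castSucc)) *
          (if (∀ i, P (Fin.last d) i = Pauli.I ∨ P (Fin.last d) i = Pauli.Z)
            then ((1 - r) ^ 2) ^ strWeight (P (Fin.last d)) else 0) := by
  intro d
  induction d with
  | zero =>
    intro U x₀ P ε _ _
    rw [sectorTrans_noLayers, Finset.univ_eq_empty, Finset.prod_empty, one_mul]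
    rfl
  | succ d ih =>
    intro U x₀ P ε hconj hε
    have h0 : U 0 * pauliString (P 0) * (U 0)ᴴ = ε 0 • pauliString (P (Fin.succ 0)) := by
      simpa only [Fin.castSucc_zero] using hconj 0
    rw [sectorTrans_conj_head r U x₀ h0 (hε 0),
      show sectorTrans r (Fin.tail U) x₀ (P (Fin.succ 0)) = _ from
        ih (Fin.tail U) x₀ (Fin.tail P) (Fin.tail ε)
          (fun t => by simpa only [Fin.tail, Fin.succ_castSucc] using hconj t.succ) (fun t => hε t.succ),
      Fin.prod_univ_succ]
    simp only [Fin.tail, Fin.succ_last, Fin.castSucc_zero, Fin.succ_castSucc, mul_assoc]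

/-! ## §2 The first-moment profile mass is a stabiliser-intersection count (Z2) -/

/-- The total profile mass regrouped over strings: `Σ_{k ≤ n} V_k(C) = Σ_{P ∈ {I,Z}ⁿ} π_C(P)`.
[cite: AharonovEtAl2023, Definition 5 (Fourier weight by degree, summed over degrees)] -/
theorem profileMass_eq_sum_sectorTrans (r : ℝ) {d : ℕ} (U : Fin d → Matrix (ι → Bool) (ι → Bool) ℂ)
    (x₀ : ι → Bool) :
    ∑ k ∈ Finset.range (Fintype.card ι + 1), inputProfile r U x₀ k =
      ∑ P ∈ Finset.univ.filter (fun P : ι → Pauli => ∀ i, P i = Pauli.I ∨ P i = Pauli.Z),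
        sectorTrans r U x₀ P := by
  unfold inputProfile
  rw [Finset.sum_fiberwise_of_maps_to (s := Finset.univ) (t := Finset.range (Fintype.card ι + 1))
      (g := strWeight) (fun P _ => Finset.mem_range.2 (Nat.lt_succ_of_le (strWeight_le_card P))),
    Finset.sum_filter]
  refine Finset.sum_congr rfl fun P _ => ?_
  rw [norm_sq_trace_pauliString_mul_proj]
  split_ifs <;> simp

/-- **Z2 (any rate).** With tracked images `path P t` (`path P 0 = P`) the total first-moment
profile mass is a WEIGHTED COUNT over the diagonal strings whose final image is diagonal:
`Σ_k V_k(C) = Σ_{P ∈ 𝒵, Φ_C(P) ∈ 𝒵} Π_{t<d}((1−r)²)^{|P_t|}·((1−r)²)^{|Φ_C(P)|}`. [cite: FeffermanEtAl2023, §10 Remarks 20–22; AharonovEtAl2023, Definition 5] -/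
theorem profileMass_eq_sum_pathWeights (r : ℝ) {d : ℕ} (U : Fin d → Matrix (ι → Bool) (ι → Bool) ℂ)
    (x₀ : ι → Bool) (path : (ι → Pauli) → Fin (d + 1) → ι → Pauli) (ε : (ι → Pauli) → Fin d → ℂ)
    (h0 : ∀ P, path P 0 = P)
    (hconj : ∀ P, (∀ i, P i = Pauli.I ∨ P i = Pauli.Z) → ∀ t : Fin d,
      U t * pauliString (path P t.castSucc) * (U t)ᴴ = ε P t • pauliString (path P t.succ))
    (hε : ∀ P, (∀ i, P i = Pauli.I ∨ P i = Pauli.Z) → ∀ t, ‖ε P t‖ = 1) :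
    ∑ k ∈ Finset.range (Fintype.card ι + 1), inputProfile r U x₀ k =
      ∑ P ∈ (Finset.univ.filter (fun P : ι → Pauli => ∀ i, P i = Pauli.I ∨ P i = Pauli.Z)).filter
          (fun P => ∀ i, path P (Fin.last d) i = Pauli.I ∨ path P (Fin.last d) i = Pauli.Z),
        (∏ t : Fin d, ((1 - r) ^ 2) ^ strWeight (path P t.castSucc)) *
          ((1 - r) ^ 2) ^ strWeight (path P (Fin.last d)) := by
  rw [profileMass_eq_sum_sectorTrans]
  conv_rhs => rw [Finset.sum_filter]
  refine Finset.sum_congr rfl fun P hP => ?_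
  have hPZ := (Finset.mem_filter.1 hP).2
  rw [← h0 P, sectorTrans_conj_path r U x₀ (path P) (ε P) (hconj P hPZ) (hε P hPZ), h0 P]
  split_ifs <;> simp

/-- **Z2 at `r = 0` (THE STABILISER-INTERSECTION COUNT).** `Σ_k V_k(C) = |𝒵 ∩ Φ_C⁻¹𝒵|`: the number
of diagonal strings whose image through the suffix is diagonal (for a Clifford `C` the intersection of
two maximal abelian Pauli subgroups — remark); certified excess `α′_C = |𝒵 ∩ Φ_C⁻¹𝒵| − 1`. [cite: FeffermanEtAl2023, §10 Remarks 20–22; AharonovEtAl2023, Lemma 4] -/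
theorem profileMass_zero_eq_card {d : ℕ} (U : Fin d → Matrix (ι → Bool) (ι → Bool) ℂ)
    (x₀ : ι → Bool) (path : (ι → Pauli) → Fin (d + 1) → ι → Pauli) (ε : (ι → Pauli) → Fin d → ℂ)
    (h0 : ∀ P, path P 0 = P)
    (hconj : ∀ P, (∀ i, P i = Pauli.I ∨ P i = Pauli.Z) → ∀ t : Fin d,
      U t * pauliString (path P t.castSucc) * (U t)ᴴ = ε P t • pauliString (path P t.succ))
    (hε : ∀ P, (∀ i, P i = Pauli.I ∨ P i = Pauli.Z) → ∀ t, ‖ε P t‖ = 1) :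
    ∑ k ∈ Finset.range (Fintype.card ι + 1), inputProfile 0 U x₀ k =
      (((Finset.univ.filter (fun P : ι → Pauli => ∀ i, P i = Pauli.I ∨ P i = Pauli.Z)).filter
          (fun P => ∀ i, path P (Fin.last d) i = Pauli.I ∨ path P (Fin.last d) i = Pauli.Z)).card : ℝ) := by
  rw [profileMass_eq_sum_pathWeights 0 U x₀ path ε h0 hconj hε]
  simp

/-- The diagonal strings `𝒵 = {I,Z}ⁿ` number `2ⁿ`. [cite: KempeEtAl2010, §2 (Pauli strings)] -/
theorem card_filter_ZType :
    (Finset.univ.filter (fun P : ι → Pauli => ∀ i, P i = Pauli.I ∨ P i = Pauli.Z)).card =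
      2 ^ Fintype.card ι := by
  classical
  let e : (ι → Bool) → (ι → Pauli) := fun b i => if b i then Pauli.Z else Pauli.I
  have he : Function.Injective e := by
    intro b b' h
    funext i
    have hi := congrFun h i
    simp only [e] at hi
    cases hb : b i <;> cases hb' : b' i <;> simp [hb, hb'] at hi ⊢
  have himage : Finset.univ.image e =
      Finset.univ.filter (fun P : ι → Pauli => ∀ i, P i = Pauli.I ∨ P i = Pauli.Z) := by
    ext P
    simp only [Finset.mem_image, Finset.mem_univ, true_and, Finset.mem_filter]
    constructor
    · rintro ⟨b, rfl⟩ i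
      simp only [e]
      cases b i <;> simp
    · intro hP
      refine ⟨fun i => decide (P i = Pauli.Z), ?_⟩
      funext i
      rcases hP i with h | h <;> simp [e, h]
  rw [← himage, Finset.card_image_of_injective _ he, Finset.card_univ, Fintype.card_fun, Fintype.card_bool]

/-! ## §3 Averaging over a gate family that hits the diagonal strings uniformly (Z3) -/

/-- **Z3 (uniform diagonal hits ⇒ averaged count).** If every NON-identity diagonal string has a
diagonal final image for exactly `b` of the `|J|` members (binder `hb`; the identity string always
has, `hI`), the family's total profile mass is `|J| + b·(2ⁿ − 1)`: member-averaged certified excess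
`ᾱ′ = b(2ⁿ−1)/|J|` (uniform `n`-qubit Clifford measure: `b/|J| = (2ⁿ−1)/(4ⁿ−1) = 1/(2ⁿ+1)` by orbit
counting — an untyped remark; typed at `n = 2` in §4). [cite: FeffermanEtAl2023, §10 Remark 22 (random two-qubit gates in the last layer); DalzellHunterJonesBrandao2022, Theorem 1 (the diagonal-suffix contrast)] -/
theorem family_profileMass {J : Type*} [Fintype J] {d : ℕ}
    (U : J → Fin d → Matrix (ι → Bool) (ι → Bool) ℂ) (x₀ : ι → Bool)
    (path : J → (ι → Pauli) → Fin (d + 1) → ι → Pauli) (ε : J → (ι → Pauli) → Fin d → ℂ)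
    (h0 : ∀ j P, path j P 0 = P)
    (hconj : ∀ j P, (∀ i, P i = Pauli.I ∨ P i = Pauli.Z) → ∀ t : Fin d,
      U j t * pauliString (path j P t.castSucc) * (U j t)ᴴ = ε j P t • pauliString (path j P t.succ))
    (hε : ∀ j P, (∀ i, P i = Pauli.I ∨ P i = Pauli.Z) → ∀ t, ‖ε j P t‖ = 1) (b : ℕ)
    (hb : ∀ P, (∀ i, P i = Pauli.I ∨ P i = Pauli.Z) → P ≠ (fun _ => Pauli.I) →
      (Finset.univ.filter fun j =>
        ∀ i, path j P (Fin.last d) i = Pauli.I ∨ path j P (Fin.last d) i = Pauli.Z).card = b)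
    (hI : ∀ j i, path j (fun _ => Pauli.I) (Fin.last d) i = Pauli.I ∨
      path j (fun _ => Pauli.I) (Fin.last d) i = Pauli.Z) :
    ∑ j, ∑ k ∈ Finset.range (Fintype.card ι + 1), inputProfile 0 (U j) x₀ k =
      (Fintype.card J : ℝ) + b * ((2 : ℝ) ^ Fintype.card ι - 1) := by
  classical
  set D := Finset.univ.filter (fun P : ι → Pauli => ∀ i, P i = Pauli.I ∨ P i = Pauli.Z) with hD
  have hID : (fun _ : ι => Pauli.I) ∈ D := by simp [hD]
  calc ∑ j, ∑ k ∈ Finset.range (Fintype.card ι + 1), inputProfile 0 (U j) x₀ k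
      = ∑ j, ∑ P ∈ D, (if (∀ i, path j P (Fin.last d) i = Pauli.I ∨ path j P (Fin.last d) i = Pauli.Z)
          then (1 : ℝ) else 0) :=
        Finset.sum_congr rfl fun j _ => by
          rw [profileMass_zero_eq_card (U j) x₀ (path j) (ε j) (h0 j) (hconj j) (hε j), Finset.sum_boole]
    _ = ∑ P ∈ D, ∑ j, (if (∀ i, path j P (Fin.last d) i = Pauli.I ∨ path j P (Fin.last d) i = Pauli.Z)
          then (1 : ℝ) else 0) := Finset.sum_comm
    _ = ∑ P ∈ D, ((Finset.univ.filter fun j =>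
          ∀ i, path j P (Fin.last d) i = Pauli.I ∨ path j P (Fin.last d) i = Pauli.Z).card : ℝ) :=
        Finset.sum_congr rfl fun P _ => by rw [Finset.sum_boole]
    _ = (Fintype.card J : ℝ) + ∑ P ∈ D.erase (fun _ => Pauli.I), ((Finset.univ.filter fun j =>
          ∀ i, path j P (Fin.last d) i = Pauli.I ∨ path j P (Fin.last d) i = Pauli.Z).card : ℝ) := by
        rw [← Finset.add_sum_erase D _ hID, Finset.filter_true_of_mem (fun j _ => hI j), Finset.card_univ]
    _ = (Fintype.card J : ℝ) + ∑ P ∈ D.erase (fun _ => Pauli.I), (b : ℝ) := by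
        congr 1
        refine Finset.sum_congr rfl fun P hP => ?_
        rw [Finset.mem_erase] at hP
        rw [hb P (Finset.mem_filter.1 hP.2).2 hP.1]
    _ = (Fintype.card J : ℝ) + b * ((2 : ℝ) ^ Fintype.card ι - 1) := by
        rw [Finset.sum_const, nsmul_eq_mul, Finset.card_erase_of_mem hID, hD, card_filter_ZType,
          Nat.cast_sub (Nat.one_le_two_pow), Nat.cast_pow, Nat.cast_two, Nat.cast_one, mul_comm]

/-- **Z3, certificate form.** By the upper half of the sibling sandwich, a family of clean unitary
suffixes with total profile mass `M` has `Σ_j Ψ_{C_j}(q) ≤ |J| + q²(M − |J|)`; with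
`family_profileMass`, `M − |J| = b(2ⁿ−1)`: average certificate `≤ 1 + q²·b(2ⁿ−1)/|J|` (Clifford-uniform
ratio: an average excess `< q²`, against `(1+q²)ⁿ − 1` behind a diagonal suffix) — the SIZE of the
first-moment / Jensen certificate behind a diagonal-scrambling family, even at perfect transmission;
not a statement about sampling hardness. [cite: FeffermanEtAl2023, §10 Remark 22 and p. 16 («see-saw»); DalzellHunterJonesBrandao2022, Theorem 1] -/
theorem avg_certificate_le_of_mass {J : Type*} [Fintype J] {d : ℕ}
    (U : J → Fin d → Matrix (ι → Bool) (ι → Bool) ℂ)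
    (hU : ∀ j t, U j t ∈ Matrix.unitaryGroup (ι → Bool) ℂ) (x₀ : ι → Bool) {M : ℝ}
    (hmass : ∑ j, ∑ k ∈ Finset.range (Fintype.card ι + 1), inputProfile 0 (U j) x₀ k = M)
    {q : ℝ} (hq0 : 0 ≤ q) (hq1 : q ≤ 1) :
    ∑ j, ∑ k ∈ Finset.range (Fintype.card ι + 1), (q ^ 2) ^ k * inputProfile 0 (U j) x₀ k ≤
      (Fintype.card J : ℝ) + q ^ 2 * (M - Fintype.card J) := by
  have hj : ∀ j, ∑ k ∈ Finset.range (Fintype.card ι + 1), (q ^ 2) ^ k * inputProfile 0 (U j) x₀ k ≤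
      1 + q ^ 2 * (∑ k ∈ Finset.range (Fintype.card ι + 1), inputProfile 0 (U j) x₀ k - 1) := by
    intro j
    have h := (profile_sandwich 0 (hU j) x₀ hq0 hq1).2
    linarith
  calc ∑ j, ∑ k ∈ Finset.range (Fintype.card ι + 1), (q ^ 2) ^ k * inputProfile 0 (U j) x₀ k
      ≤ ∑ j, (1 + q ^ 2 * (∑ k ∈ Finset.range (Fintype.card ι + 1), inputProfile 0 (U j) x₀ k - 1)) :=
        Finset.sum_le_sum fun j _ => hj j
    _ = (Fintype.card J : ℝ) + q ^ 2 * (M - Fintype.card J) := by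
        rw [Finset.sum_add_distrib, Finset.sum_const, Finset.card_univ, nsmul_eq_mul, mul_one,
          ← Finset.mul_sum, Finset.sum_sub_distrib, Finset.sum_const, Finset.card_univ, nsmul_eq_mul, mul_one,
          hmass]

/-! ## §4 The π/2 string rotations `exp(−iπ/4·σ_Q)` and the typed `n = 2` witnesses (Z4) -/

/-- The Clifford rotation `R_Q := exp(−iπ/4·σ_Q) = (1 − i·σ_Q)/√2` about a Pauli string `Q`
(generalising the parity layer `R_{X⊗X}` of the sibling module). [cite: FeffermanEtAl2023, §10 Remark 22 (noiseless Clifford last layers); KempeEtAl2010, §2 (Pauli strings)] -/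
noncomputable def rot (Q : ι → Pauli) : Matrix (ι → Bool) (ι → Bool) ℂ :=
  ((Real.sqrt 2 : ℝ) : ℂ)⁻¹ • ((1 : Matrix (ι → Bool) (ι → Bool) ℂ) - Complex.I • pauliString Q)

/-- `(1/√2)·(1/√2) = 2⁻¹` in `ℂ`. [folklore] -/
private theorem inv_sqrt_two_mul_self : ((Real.sqrt 2 : ℝ) : ℂ)⁻¹ * ((Real.sqrt 2 : ℝ) : ℂ)⁻¹ = 2⁻¹ := by
  rw [← mul_inv, ← Complex.ofReal_mul, Real.mul_self_sqrt (by norm_num : (0 : ℝ) ≤ 2)]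
  push_cast
  ring

omit [DecidableEq ι] in
/-- `R_Q† = (1 + i·σ_Q)/√2`. [folklore] -/
private theorem rot_conjTranspose (Q : ι → Pauli) :
    (rot Q)ᴴ = ((Real.sqrt 2 : ℝ) : ℂ)⁻¹ • ((1 : Matrix (ι → Bool) (ι → Bool) ℂ) + Complex.I • pauliString Q) := by
  simp [rot, Matrix.conjTranspose_smul, Matrix.conjTranspose_sub, conjTranspose_pauliString]

/-- **Z4.** `R_Q` is unitary. [cite: KempeEtAl2010, §2 (σ_Q² = 1)] -/
theorem rot_unitary (Q : ι → Pauli) : rot Q ∈ Matrix.unitaryGroup (ι → Bool) ℂ := by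
  rw [Matrix.mem_unitaryGroup_iff, Matrix.star_eq_conjTranspose, rot_conjTranspose, rot,
    Matrix.smul_mul, Matrix.mul_smul, smul_smul, inv_sqrt_two_mul_self]
  have h : ((1 : Matrix (ι → Bool) (ι → Bool) ℂ) - Complex.I • pauliString Q) * (1 + Complex.I • pauliString Q) =
      (2 : ℂ) • 1 := by
    rw [sub_mul, mul_add, mul_add, one_mul, one_mul, mul_one, Matrix.smul_mul, Matrix.mul_smul, smul_smul,
      Complex.I_mul_I, pauliString_mul_self]
    module
  rw [h, smul_smul]
  norm_num

/-- Conjugation rule of `R_Q`: `R_Q σ_P R_Q† = ((1+χ)/2)·σ_P + (i(1−χ)/2)·σ_P σ_Q` with `χ = strSign Q P`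
the commutation character. [folklore] -/
private theorem rot_conj (Q P : ι → Pauli) :
    rot Q * pauliString P * (rot Q)ᴴ =
      ((1 + strSign Q P) / 2) • pauliString P +
        (Complex.I * (1 - strSign Q P) / 2) • (pauliString P * pauliString Q) := by
  set sgnP : ℂ := strSign Q P with hsgnP
  have hAσA : pauliString Q * pauliString P * pauliString Q = sgnP • pauliString P :=
    pauliString_conj_eq_strSign_smul _ _
  have hAσ : pauliString Q * pauliString P = sgnP • (pauliString P * pauliString Q) := by
    calc pauliString Q * pauliString P
        = pauliString Q * pauliString P * (pauliString Q * pauliString Q) := by rw [pauliString_mul_self, mul_one]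
      _ = (pauliString Q * pauliString P * pauliString Q) * pauliString Q := by simp only [Matrix.mul_assoc]
      _ = sgnP • (pauliString P * pauliString Q) := by rw [hAσA, Matrix.smul_mul]
  rw [rot_conjTranspose, rot, Matrix.smul_mul, Matrix.smul_mul, Matrix.mul_smul, smul_smul, inv_sqrt_two_mul_self]
  have h : ((1 : Matrix (ι → Bool) (ι → Bool) ℂ) - Complex.I • pauliString Q) * pauliString P *
        (1 + Complex.I • pauliString Q) =
      (1 + sgnP) • pauliString P + (Complex.I * (1 - sgnP)) • (pauliString P * pauliString Q) := by
    rw [sub_mul, one_mul, Matrix.smul_mul, hAσ, sub_mul, mul_add, mul_add, mul_one]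
    simp only [Matrix.smul_mul, Matrix.mul_smul, Matrix.mul_assoc, pauliString_mul_self, Matrix.mul_one, smul_smul]
    ext i j
    simp only [Matrix.add_apply, Matrix.sub_apply, Matrix.smul_apply, smul_eq_mul]
    linear_combination (-sgnP * (pauliString P) i j) * Complex.I_mul_I
  rw [h, smul_add, smul_smul, smul_smul]
  congr 1 <;> congr 1 <;> ring

/-- **Z4.** Strings commuting with `Q` are fixed by `R_Q`. [cite: KempeEtAl2010, §2 Observation 4 (commutation character of strings)] -/
theorem rot_conj_of_comm {Q P : ι → Pauli} (h : strSign Q P = 1) :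
    rot Q * pauliString P * (rot Q)ᴴ = (1 : ℂ) • pauliString P := by
  rw [rot_conj, h]
  have h1 : ((1 : ℂ) + 1) / 2 = 1 := by ring
  have h2 : Complex.I * (1 - 1) / 2 = 0 := by ring
  rw [h1, h2, zero_smul, add_zero]

/-- **Z4.** Strings anticommuting with `Q` are sent by `R_Q` to `i·σ_P σ_Q` (again a string, up to a
unit phase). [cite: KempeEtAl2010, §2 Observation 4] -/
theorem rot_conj_of_anti {Q P : ι → Pauli} (h : strSign Q P = -1) :
    rot Q * pauliString P * (rot Q)ᴴ = Complex.I • (pauliString P * pauliString Q) := by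
  rw [rot_conj, h]
  have h1 : ((1 : ℂ) + -1) / 2 = 0 := by ring
  have h2 : Complex.I * (1 - -1) / 2 = Complex.I := by ring
  rw [h1, h2, zero_smul, zero_add]

/-- **Z4 (relation to the sibling module, no second rotation object).** The parity layer of
`CleanSuffixProfileExtremes` is the string rotation about `X⊗X`: `parityU = rot (X⊗X)`. [cite: FeffermanEtAl2023, §10 Remark 22] -/
theorem parityU_eq_rot : parityU = rot (str2 Pauli.X Pauli.X) := rfl

/-! ### The register `n = 2`: one clean layer `V := R_{X⊗1}·R_{1⊗X}` of single-qubit π/2 X-rotations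
(`Z⊗1 ↦ −Y⊗1`, `1⊗Z ↦ −1⊗Y`, `Z⊗Z ↦ Y⊗Y`: trivial diagonal intersection) and the five-member family
`{1, V, V, V, V}` hitting every non-identity diagonal string exactly once (`b/|J| = 1/5 = 1/(2ⁿ+1)`). -/

/-- The clean layer `V := R_{X⊗1}·R_{1⊗X} = exp(−iπ/4·X)⊗exp(−iπ/4·X)` on the two-site register (a
product of single-qubit Cliffords — NOT entangling). [cite: FeffermanEtAl2023, §10 Remarks 20–22; KempeEtAl2010, §2] -/
noncomputable def vx : Matrix (Bool → Bool) (Bool → Bool) ℂ :=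
  rot (str2 Pauli.X Pauli.I) * rot (str2 Pauli.I Pauli.X)

/-- **Z4.** `V` is unitary. [cite: KempeEtAl2010, §2] -/
theorem vx_unitary : vx ∈ Matrix.unitaryGroup (Bool → Bool) ℂ :=
  Submonoid.mul_mem _ (rot_unitary _) (rot_unitary _)

/-- The one-layer clean suffix consisting of `V`. [cite: FeffermanEtAl2023, §10 Remark 22] -/
noncomputable def vxC : Fin 1 → Matrix (Bool → Bool) (Bool → Bool) ℂ := fun _ => vx

/-- The single-site products used below: `Z·X = i·Y` (and `1` is the identity letter). [folklore] -/
private theorem matZ_mul_matX_and :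
    Pauli.mat Pauli.Z * Pauli.mat Pauli.X = Complex.I • Pauli.mat Pauli.Y ∧
      Pauli.mat Pauli.I = (1 : Matrix Bool Bool ℂ) := by
  refine ⟨?_, rfl⟩
  ext a b
  cases a <;> cases b <;> simp [Pauli.mul_apply_bool]

/-- `(Z⊗1)(X⊗1) = i·(Y⊗1)`. [folklore] -/
private theorem ZI_mul_XI : pauliString (str2 Pauli.Z Pauli.I) * pauliString (str2 Pauli.X Pauli.I) =
    Complex.I • pauliString (str2 Pauli.Y Pauli.I) := by
  rw [pauliString_eq, pauliString_eq, pauliString_eq, tensorAll_mul]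
  ext x y
  simp only [tensorAll_apply, Matrix.smul_apply, smul_eq_mul, Fintype.prod_bool, str2, cond_true, cond_false,
    matZ_mul_matX_and.1, matZ_mul_matX_and.2, Matrix.one_mul]
  ring

/-- `(1⊗Z)(1⊗X) = i·(1⊗Y)`. [folklore] -/
private theorem IZ_mul_IX : pauliString (str2 Pauli.I Pauli.Z) * pauliString (str2 Pauli.I Pauli.X) =
    Complex.I • pauliString (str2 Pauli.I Pauli.Y) := by
  rw [pauliString_eq, pauliString_eq, pauliString_eq, tensorAll_mul]
  ext x y
  simp only [tensorAll_apply, Matrix.smul_apply, smul_eq_mul, Fintype.prod_bool, str2, cond_true, cond_false,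
    matZ_mul_matX_and.1, matZ_mul_matX_and.2, Matrix.one_mul]
  ring

/-- `(Z⊗Z)(1⊗X) = i·(Z⊗Y)`. [folklore] -/
private theorem ZZ_mul_IX : pauliString (str2 Pauli.Z Pauli.Z) * pauliString (str2 Pauli.I Pauli.X) =
    Complex.I • pauliString (str2 Pauli.Z Pauli.Y) := by
  rw [pauliString_eq, pauliString_eq, pauliString_eq, tensorAll_mul]
  ext x y
  simp only [tensorAll_apply, Matrix.smul_apply, smul_eq_mul, Fintype.prod_bool, str2, cond_true, cond_false,
    matZ_mul_matX_and.1, matZ_mul_matX_and.2, Matrix.mul_one]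
  ring

/-- `(Z⊗Y)(X⊗1) = i·(Y⊗Y)`. [folklore] -/
private theorem ZY_mul_XI : pauliString (str2 Pauli.Z Pauli.Y) * pauliString (str2 Pauli.X Pauli.I) =
    Complex.I • pauliString (str2 Pauli.Y Pauli.Y) := by
  rw [pauliString_eq, pauliString_eq, pauliString_eq, tensorAll_mul]
  ext x y
  simp only [tensorAll_apply, Matrix.smul_apply, smul_eq_mul, Fintype.prod_bool, str2, cond_true, cond_false,
    matZ_mul_matX_and.1, matZ_mul_matX_and.2, Matrix.mul_one]
  ring

/-- Conjugation by `V = R₁R₂` is conjugation by `R₂` then by `R₁`. [folklore] -/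
private theorem vx_conj_eq (M : Matrix (Bool → Bool) (Bool → Bool) ℂ) :
    vx * M * vxᴴ = rot (str2 Pauli.X Pauli.I) *
      (rot (str2 Pauli.I Pauli.X) * M * (rot (str2 Pauli.I Pauli.X))ᴴ) * (rot (str2 Pauli.X Pauli.I))ᴴ := by
  simp only [vx, Matrix.conjTranspose_mul, Matrix.mul_assoc]

/-- **Z4.** `V (Z⊗1) V† = −(Y⊗1)`. [cite: FeffermanEtAl2023, §10 Remark 20 (σ_z sectors rotated out of the read-out basis); KempeEtAl2010, §2 Observation 4] -/
theorem vx_conj_ZI :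
    vx * pauliString (str2 Pauli.Z Pauli.I) * vxᴴ = (-1 : ℂ) • pauliString (str2 Pauli.Y Pauli.I) := by
  rw [vx_conj_eq, rot_conj_of_comm (by simp [strSign_eq, Pauli.sign, str2]),
    one_smul, rot_conj_of_anti (by simp [strSign_eq, Pauli.sign, str2]), ZI_mul_XI, smul_smul, Complex.I_mul_I]

/-- **Z4.** `V (1⊗Z) V† = −(1⊗Y)`. [cite: FeffermanEtAl2023, §10 Remark 20; KempeEtAl2010, §2 Observation 4] -/
theorem vx_conj_IZ :
    vx * pauliString (str2 Pauli.I Pauli.Z) * vxᴴ = (-1 : ℂ) • pauliString (str2 Pauli.I Pauli.Y) := by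
  rw [vx_conj_eq, rot_conj_of_anti (by simp [strSign_eq, Pauli.sign, str2]), IZ_mul_IX, smul_smul,
    Complex.I_mul_I, Matrix.mul_smul, Matrix.smul_mul, rot_conj_of_comm (by simp [strSign_eq, Pauli.sign, str2]),
    one_smul]

/-- **Z4.** `V (Z⊗Z) V† = Y⊗Y`. [cite: FeffermanEtAl2023, §10 Remark 20; KempeEtAl2010, §2 Observation 4] -/
theorem vx_conj_ZZ :
    vx * pauliString (str2 Pauli.Z Pauli.Z) * vxᴴ = (1 : ℂ) • pauliString (str2 Pauli.Y Pauli.Y) := by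
  rw [vx_conj_eq, rot_conj_of_anti (by simp [strSign_eq, Pauli.sign, str2]), ZZ_mul_IX, smul_smul,
    Complex.I_mul_I, Matrix.mul_smul, Matrix.smul_mul, rot_conj_of_anti (by simp [strSign_eq, Pauli.sign, str2]),
    ZY_mul_XI, smul_smul, smul_smul]
  congr 1
  rw [mul_assoc, Complex.I_mul_I]; ring

/-- **Z4.** `V (1⊗1) V† = 1⊗1`. [cite: KempeEtAl2010, §2] -/
theorem vx_conj_II :
    vx * pauliString (str2 Pauli.I Pauli.I) * vxᴴ = (1 : ℂ) • pauliString (str2 Pauli.I Pauli.I) := by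
  rw [vx_conj_eq, rot_conj_of_comm (by simp [strSign_eq, Pauli.sign, str2]), one_smul,
    rot_conj_of_comm (by simp [strSign_eq, Pauli.sign, str2]), one_smul]

/-- The four diagonal strings of the two-site register. [folklore] -/
private theorem ZType_cases {P : Bool → Pauli} (hZ : ∀ i, P i = Pauli.I ∨ P i = Pauli.Z) :
    P = str2 Pauli.I Pauli.I ∨ P = str2 Pauli.Z Pauli.I ∨ P = str2 Pauli.I Pauli.Z ∨ P = str2 Pauli.Z Pauli.Z := by
  rw [show P = str2 (P false) (P true) from funext fun i => by cases i <;> rfl]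
  rcases hZ false with h0 | h0 <;> rcases hZ true with h1 | h1 <;> simp [h0, h1]

/-- **Z4 (TOTAL FIRST-MOMENT BLINDNESS behind one layer of single-qubit π/2 X-rotations, every rate,
every letter).** `Ψ_V(q) = Σ_k q^{2k} V_k(V) = 1` identically: all diagonal input sectors leave the
read-out basis, so the uniform-first-moment / Jensen route certifies exactly the uniform collision value —
no entangling gate is needed to blind it. [cite: FeffermanEtAl2023, §10 Remarks 20 and 22, p. 16 («see-saw»); AharonovEtAl2023, Lemma 4] -/
theorem vxC_certificate_eq_one (r : ℝ) (x₀ : Bool → Bool) (q : ℝ) :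
    ∑ k ∈ Finset.range (Fintype.card Bool + 1), (q ^ 2) ^ k * inputProfile r vxC x₀ k = 1 := by
  have hV : ∀ k, 0 < k → inputProfile r vxC x₀ k = 0 := by
    intro k hk
    refine inputProfile_eq_zero_of_opaque r vxC x₀ k fun P hZ hw => ?_
    rcases ZType_cases hZ with rfl | rfl | rfl | rfl
    · exact absurd hw (by rw [show strWeight (str2 Pauli.I Pauli.I) = 0 by decide]; omega)
    · exact ⟨-1, str2 Pauli.Y Pauli.I, vx_conj_ZI, by simp, fun h => by rcases h false with h | h <;> simp [str2] at h⟩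
    · exact ⟨-1, str2 Pauli.I Pauli.Y, vx_conj_IZ, by simp, fun h => by rcases h true with h | h <;> simp [str2] at h⟩
    · exact ⟨1, str2 Pauli.Y Pauli.Y, vx_conj_ZZ, by simp, fun h => by rcases h false with h | h <;> simp [str2] at h⟩
  rw [Fintype.card_bool, Finset.sum_range_succ, Finset.sum_range_succ, Finset.sum_range_one, pow_zero, one_mul,
    inputProfile_zero r (U := vxC) (fun _ => vx_unitary), hV 1 one_pos, hV 2 two_pos]
  ring

/-- The letter map of `V` on strings (sitewise `Z ↦ Y`, `Y ↦ Z`, `I`, `X` fixed; the string image up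
to sign). [cite: KempeEtAl2010, §2 Observation 4] -/
def vxLetter : Pauli → Pauli
  | Pauli.I => Pauli.I
  | Pauli.X => Pauli.X
  | Pauli.Y => Pauli.Z
  | Pauli.Z => Pauli.Y

/-- The tracked string path through the one-layer suffix `V`: `(P, Φ_V P)` with `Φ_V` sitewise
`vxLetter`. [cite: FeffermanEtAl2023, §10 Remark 20] -/
def vxPath (P : Bool → Pauli) : Fin 2 → Bool → Pauli := ![P, fun i => vxLetter (P i)]

/-- **Z4 (the tracked-image interface of §2–§3 is met by `V`).** [cite: FeffermanEtAl2023, §10 Remark 20; KempeEtAl2010, §2 Observation 4] -/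
theorem vxPath_conj (P : Bool → Pauli) (hZ : ∀ i, P i = Pauli.I ∨ P i = Pauli.Z) (t : Fin 1) :
    vxC t * pauliString (vxPath P t.castSucc) * (vxC t)ᴴ =
      ((-1 : ℂ) ^ strWeight P) • pauliString (vxPath P t.succ) := by
  obtain rfl : t = 0 := Subsingleton.elim _ _
  simp only [vxC, vxPath, Fin.castSucc_zero, Fin.succ_zero_eq_one, Matrix.cons_val_zero, Matrix.cons_val_one]
  rcases ZType_cases hZ with rfl | rfl | rfl | rfl
  · rw [show strWeight (str2 Pauli.I Pauli.I) = 0 by decide, pow_zero,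
      show (fun i => vxLetter (str2 Pauli.I Pauli.I i)) = str2 Pauli.I Pauli.I by funext i; cases i <;> rfl]
    exact vx_conj_II
  · rw [show strWeight (str2 Pauli.Z Pauli.I) = 1 by decide, pow_one,
      show (fun i => vxLetter (str2 Pauli.Z Pauli.I i)) = str2 Pauli.Y Pauli.I by funext i; cases i <;> rfl]
    exact vx_conj_ZI
  · rw [show strWeight (str2 Pauli.I Pauli.Z) = 1 by decide, pow_one,
      show (fun i => vxLetter (str2 Pauli.I Pauli.Z i)) = str2 Pauli.I Pauli.Y by funext i; cases i <;> rfl]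
    exact vx_conj_IZ
  · rw [show strWeight (str2 Pauli.Z Pauli.Z) = 2 by decide,
      show (fun i => vxLetter (str2 Pauli.Z Pauli.Z i)) = str2 Pauli.Y Pauli.Y by funext i; cases i <;> rfl]
    rw [show ((-1 : ℂ)) ^ 2 = 1 by norm_num]
    exact vx_conj_ZZ

/-- The identity layer meets the interface trivially (constant path, unit phases). [cite: KempeEtAl2010, §2] -/
theorem idPath_conj (P : Bool → Pauli) (t : Fin 1) :
    idLayer t * pauliString ((![P, P] : Fin 2 → Bool → Pauli) t.castSucc) * (idLayer t)ᴴ =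
      (1 : ℂ) • pauliString ((![P, P] : Fin 2 → Bool → Pauli) t.succ) := by
  obtain rfl : t = 0 := Subsingleton.elim _ _
  simp [idLayer]

/-- The five-member family `{1, V, V, V, V}` of one-layer clean suffixes on two qubits.
[cite: FeffermanEtAl2023, §10 Remark 22 (random gates in the last layer)] -/
noncomputable def fam5 : Fin 5 → Fin 1 → Matrix (Bool → Bool) (Bool → Bool) ℂ :=
  fun j => if j = 0 then idLayer else vxC

/-- Tracked paths of the family. [cite: FeffermanEtAl2023, §10 Remark 20] -/
def fam5Path : Fin 5 → (Bool → Pauli) → Fin 2 → Bool → Pauli :=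
  fun j P => if j = 0 then ![P, P] else vxPath P

/-- Phases of the family. [cite: KempeEtAl2010, §2] -/
def fam5Phase : Fin 5 → (Bool → Pauli) → Fin 1 → ℂ :=
  fun j P _ => if j = 0 then 1 else (-1) ^ strWeight P

/-- The family's layers are unitary. [cite: KempeEtAl2010, §2] -/
theorem fam5_unitary : ∀ j t, fam5 j t ∈ Matrix.unitaryGroup (Bool → Bool) ℂ := by
  intro j t
  by_cases hj : j = 0
  · simp only [fam5, hj, if_true, idLayer]
    exact Submonoid.one_mem _
  · simp only [fam5, hj, if_false]
    exact vx_unitary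

/-- [folklore] -/
private theorem fam5_h0 : ∀ j P, fam5Path j P 0 = P := by
  intro j P; by_cases hj : j = 0 <;> simp [fam5Path, hj, vxPath]

/-- [folklore] -/
private theorem fam5_hconj : ∀ j P, (∀ i, P i = Pauli.I ∨ P i = Pauli.Z) → ∀ t : Fin 1,
    fam5 j t * pauliString (fam5Path j P t.castSucc) * (fam5 j t)ᴴ =
      fam5Phase j P t • pauliString (fam5Path j P t.succ) := by
  intro j P hZ t
  by_cases hj : j = 0
  · simp only [fam5, fam5Path, fam5Phase, hj, if_true]; exact idPath_conj P t
  · simp only [fam5, fam5Path, fam5Phase, hj, if_false]; exact vxPath_conj P hZ t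

/-- [folklore] -/
private theorem fam5_hε : ∀ j P, (∀ i, P i = Pauli.I ∨ P i = Pauli.Z) → ∀ t, ‖fam5Phase j P t‖ = 1 := by
  intro j P _ t; by_cases hj : j = 0 <;> simp [fam5Phase, hj]

/-- [folklore] -/
private theorem fam5_hI : ∀ j i, fam5Path j (fun _ => Pauli.I) (Fin.last 1) i = Pauli.I ∨
    fam5Path j (fun _ => Pauli.I) (Fin.last 1) i = Pauli.Z := by
  intro j i; by_cases hj : j = 0
  · simp [fam5Path, hj]
  · simp [fam5Path, hj, vxPath, vxLetter]

/-- **Z4 (UNIFORM DIAGONAL HITS, TYPED).** In the family `{1, V, V, V, V}` every non-identity diagonal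
string has a diagonal image for exactly `b = 1` member (the identity), `|J| = 5`: the ratio
`b/|J| = 1/5 = (2ⁿ−1)/(4ⁿ−1)` of the uniform two-qubit Clifford measure is attained by a typed family.
[cite: FeffermanEtAl2023, §10 Remark 22] -/
theorem fam5_uniform_hits (P : Bool → Pauli) (hZ : ∀ i, P i = Pauli.I ∨ P i = Pauli.Z)
    (hP : P ≠ fun _ => Pauli.I) :
    (Finset.univ.filter fun j => ∀ i, fam5Path j P (Fin.last 1) i = Pauli.I ∨ fam5Path j P (Fin.last 1) i = Pauli.Z).card
      = 1 := by
  rcases ZType_cases hZ with rfl | rfl | rfl | rfl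
  · exact absurd (funext fun i => by cases i <;> rfl) hP
  all_goals decide

/-- **Z4 (the averaged count for the typed family).** `Σ_j Σ_k V_k(C_j) = |J| + b(2ⁿ−1) = 5 + 3 = 8`
(identity `4`, each `V` copy `1`): average certified excess `ᾱ′ = 3/5 = (2ⁿ−1)/(2ⁿ+1)` at `n = 2`.
[cite: FeffermanEtAl2023, §10 Remark 22; DalzellHunterJonesBrandao2022, Theorem 1] -/
theorem fam5_profileMass (x₀ : Bool → Bool) :
    ∑ j, ∑ k ∈ Finset.range (Fintype.card Bool + 1), inputProfile 0 (fam5 j) x₀ k = 8 := by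
  rw [family_profileMass fam5 x₀ fam5Path fam5Phase fam5_h0 fam5_hconj fam5_hε 1
    (fun P hZ hP => by convert fam5_uniform_hits P hZ hP) fam5_hI, Fintype.card_fin, Fintype.card_bool]
  norm_num

/-- **Z4 (averaged certificate for the typed family).** `Σ_j Ψ_{C_j}(q) ≤ 5 + 3q²`: member-averaged
first-moment certificate `≤ 1 + (3/5)q² < 1 + q²` behind `{1, V, V, V, V}` — the `n = 2` value of the
Clifford-average bound `1 + q²(2ⁿ−1)/(2ⁿ+1)`. [cite: FeffermanEtAl2023, §10 Remark 22 and p. 16] -/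
theorem fam5_avg_certificate_le (x₀ : Bool → Bool) {q : ℝ} (hq0 : 0 ≤ q) (hq1 : q ≤ 1) :
    ∑ j, ∑ k ∈ Finset.range (Fintype.card Bool + 1), (q ^ 2) ^ k * inputProfile 0 (fam5 j) x₀ k ≤
      5 + 3 * q ^ 2 := by
  have h := avg_certificate_le_of_mass fam5 fam5_unitary x₀ (fam5_profileMass x₀) hq0 hq1
  have e1 : (Fintype.card (Fin 5) : ℝ) = 5 := by simp
  rw [e1] at h
  linarith

/-! ## §5 Numbers -/
/-- **Z5 (numbers).** `n = 2`: ratio `1/5 = (2²−1)/(4²−1)`, average excess `3/5 = (2²−1)/(2²+1)`;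
`n = 53`: `(2⁵³−1)/(2⁵³+1) < 1` so the Clifford-average certificate is `< 1.01` at `q² = 0.01`, against
`(1.01)⁵³ > 1.69` behind a diagonal suffix and exactly `1` behind `V`. [cite: FeffermanEtAl2023, §10 Remark 22; DalzellHunterJonesBrandao2022, Theorem 1] -/
theorem numbers :
    (1 : ℝ) / 5 = (2 ^ 2 - 1) / (4 ^ 2 - 1) ∧ (3 : ℝ) / 5 = (2 ^ 2 - 1) / (2 ^ 2 + 1) ∧
      ((2 : ℝ) ^ 53 - 1) / (2 ^ 53 + 1) < 1 ∧ (1 : ℝ) + 0.01 * ((2 ^ 53 - 1) / (2 ^ 53 + 1)) < 1.01 ∧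
      (1.69 : ℝ) < (1 + 0.01) ^ 53 ∧ (8 : ℝ) - 5 = 1 * (2 ^ 2 - 1) := by
  refine ⟨by norm_num, by norm_num, ?_, ?_, by norm_num, by norm_num⟩
  · rw [div_lt_one (by norm_num)]; norm_num
  · have h : ((2 : ℝ) ^ 53 - 1) / (2 ^ 53 + 1) < 1 := by rw [div_lt_one (by norm_num)]; norm_num
    linarith

end Literature.Computability.QuantumComplexity.PauliPath.DampingCleanSuffix.Extremes.StabilizerCount
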